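import Literature.NumberTheory.Automorphic.ReciprocityGLnPatchingGalois
import Literature.NumberTheory.Automorphic.ReciprocityGLnDescentProofs
import HarnessLib

/-!
# Harris–Lan–Taylor–Thorne's Cor. 7.14 from representations of the members of the family:
# the hand-off between the automorphic and the Galois half

Topic `Literature/NumberTheory/Automorphic`; theorems only.  `ReciprocityGLnPatchingGalois`
proves the Galois half of the printed proof of Harris–Lan–Taylor–Thorne's Cor. 7.14 = Thm. A
(`HarrisLanTaylorThorne2016.theoremA_existence`; p. 232: "This can be deduced from Theorem 7.13
by using lemma 1 of [54]. (This is the same argument used in the proof of theorem VII.1.9 of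
[29].)") over the `∅`-general family `K(√-D)`, `D ∈ GoodPrime K m B`
(`SGeneralQuadraticFamily`), for an abstract Frobenius datum `E` on `K`.  This file states the
conclusion in the vocabulary of Thm. A — `HarrisLanTaylorThorne2016.IsCompatible π ı r`:
compatibility of `r` with `π` at every place over every rational prime `q ≠ ℓ` above which `π`
is unramified (`ReciprocityGLnProofs`) — and thereby isolates exactly what the automorphic half
has to deliver:

* `exists_frobDatum` — the Frobenius datum of `π`: `E v` = the multiset of roots of
  `arithFrobPolyOfSatake ı q_v n α_v` at the places `v` where `π` is unramified (well defined:
  the Satake parameter is unique, `AutomorphicRepData.hasSatakeParamAt_unique_holds`), so that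
  `∏_{a ∈ E v}(X - a) = arithFrobPolyOfSatake ı q_v n α_v`;
* `exists_isCompatible_of_members` — **Cor. 7.14 from the members**: if for every member
  `K_D = K(√-D)` one has a continuous semisimple `ρ_D : Γ_{K_D} → GL_n(ℚ̄_ℓ)` compatible almost
  everywhere with the datum of `π` (`CompatibleAE`: for HLTT, `ρ_D = r_{ℓ,ı}(π_D)` of Thm. 7.13
  for the base change `π_D` of `π` to the CM field `K_D`, through the base-change relation
  `α_w = α_v^{f(w|v)}` almost everywhere), and if for every `q ≠ ℓ` above which `π` is
  unramified and every `v ∣ q` some member in which `v` splits completely has `ρ_D` unramified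
  with characteristic polynomial `arithFrobPolyOfSatake ı q_v n α_v` at the places above `v`
  (for HLTT: a member with `8q ∣ D + 1`, `GoodPrime.exists_dvd_split`, where Thm. 7.13 applies at
  `q` because `q` splits in `ℚ(√-D)`, and the base-change relation holds at the places above `v`),
  then there is a continuous semisimple `r : Γ_K → GL_n(ℚ̄_ℓ)` with HLTT's property
  `IsCompatible π ı r` (and `r|_{Γ_{K_D}} ≅ ρ_D` for all `D`).  Immediate from
  `GoodPrime.exists_framedGaloisRep_of_compatibleAE` with `T` = the places over the good `q`.

No automorphic theorem is proved here and no named fact is introduced: the two displayed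
hypotheses are the printed inputs "Theorem 7.13" (for the base changes of `π`; in the tree
`theorem713_of_leaves` modulo its leaves, among them the named fact
`corollary627_splitOrUnramified`) and the base change of `π` to `K_D` with its unramified local
relation (Arthur–Clozel, Ch. 3, Thm. 4.2 and (1.1); the tree has the almost-everywhere form
`exists_baseChange_cyclic` / `baseChange_cyclic_cuspidal` only), which a discharge of
`theoremA_existence` has to supply.

## References

* M. Harris, K.-W. Lan, R. Taylor, J. Thorne, *On the rigid cohomology of certain Shimura
  varieties*, Res. Math. Sci. 3:37 (2016), Thm. A (p. 3), Thm. 7.13 and Cor. 7.14 (p. 232).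
  [HarrisLanTaylorThorneRMS2016]
* M. Harris, R. Taylor, *The geometry and cohomology of some simple Shimura varieties*, Ann. of
  Math. Stud. 151 (2001), proof of Thm. VII.1.9 (pp. 229–232). [HarrisTaylorAMS2001]
* J. Arthur, L. Clozel, *Simple algebras, base change, and the advanced theory of the trace
  formula*, Ann. of Math. Stud. 120 (1989), Ch. 3, (1.1) and Thm. 4.2. [ArthurClozelAMS120]
-/

noncomputable section

open scoped MatrixGroups Matrix Classical Polynomial NumberField
open NumberField IsDedekindDomain Field Polynomial
open Literature.NumberTheory.GaloisRepresentations
open Literature.NumberTheory.GaloisRepresentations.QuadraticFamily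
open Literature.NumberTheory.Automorphic.PatchingFamily

namespace Literature.NumberTheory.Automorphic.HarrisLanTaylorThorne2016

variable {n : ℕ} {K : Type} [Field K] [NumberField K] {hcpt : isCompact_glFiniteIntegralLevel n K}
  {ℓ : ℕ} [Fact ℓ.Prime]

/-- **The Frobenius datum of `π`.**  For an automorphic representation `π` of `GL_n(𝔸_K)` and
`ı : ℚ̄_ℓ ≅ ℂ` there is a datum `E` of multisets in `ℚ̄_ℓ` on the finite places of `K` with
`∏_{a ∈ E v}(X - a) = arithFrobPolyOfSatake ı q_v n α` for every Satake parameter `α` of `π` at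
`v` (take the roots of that polynomial for the — unique,
`AutomorphicRepData.hasSatakeParamAt_unique_holds` — Satake parameter at the unramified places,
anything elsewhere; `arithFrobPolyOfSatake` is a product of linear factors,
`roots_arithFrobPolyOfSatake`). [folklore] -/
theorem exists_frobDatum (π : AutomorphicRepData (AutomorphyDatum.gl n K hcpt))
    (ι : PadicAlgCl ℓ ≃+* ℂ) :
    ∃ E : HeightOneSpectrum (𝓞 K) → Multiset (PadicAlgCl ℓ),
      ∀ (v : HeightOneSpectrum (𝓞 K)) (α : Multiset ℂ), π.HasSatakeParamAt v α →
        ((E v).map fun a ↦ X - C a).prod = arithFrobPolyOfSatake ι v.residueCard n α := by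
  classical
  refine ⟨fun v ↦ if h : ∃ α : Multiset ℂ, π.HasSatakeParamAt v α then
    (arithFrobPolyOfSatake ι v.residueCard n h.choose).roots else 0, fun v α hα ↦ ?_⟩
  have h : ∃ α : Multiset ℂ, π.HasSatakeParamAt v α := ⟨α, hα⟩
  dsimp only
  rw [dif_pos h]
  obtain rfl : α = h.choose := π.hasSatakeParamAt_unique_holds hα h.choose_spec
  rw [roots_arithFrobPolyOfSatake, arithFrobPolyOfSatake, Multiset.map_map]
  rfl

/-- **Harris–Lan–Taylor–Thorne's Cor. 7.14 from Galois representations of the members of the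
family `K(√-D)`** — the hand-off between the automorphic half (Thm. 7.13 for the base changes
`π_D` of `π` to the CM fields `K_D = K(√-D)`, `D ∈ GoodPrime K m B`, and the unramified
base-change relation) and the Galois half (`GoodPrime.exists_framedGaloisRep_of_compatibleAE`:
Chebotarev, Sorensen's patching lemma, descent at completely split places) of the printed proof.
Let `E` be the Frobenius datum of `π` (`exists_frobDatum`), `ρ_D : Γ_{K_D} → GL_n(ℚ̄_ℓ)`
continuous semisimple and compatible almost everywhere with `E` for every member, and suppose
that for every rational prime `q ≠ ℓ` above which `π` is unramified and every `v ∣ q` some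
member in which `v` splits completely has `ρ_D` unramified with characteristic polynomial
`∏_{a ∈ E v}(X - a) = arithFrobPolyOfSatake ı q_v n α_v` at every place above `v`.  Then there
is a continuous semisimple `r : Γ_K → GL_n(ℚ̄_ℓ)` with the characterising property of
`r_{ℓ,ı}(π)` in Thm. A (`IsCompatible π ı r`), restricting to `ρ_D` on every `Γ_{K_D}`.
[cite: HarrisLanTaylorThorneRMS2016, proof of Cor. 7.14 (p. 232)]
[cite: HarrisTaylorAMS2001, proof of Thm. VII.1.9 (pp. 229–232)] -/
theorem exists_isCompatible_of_members (π : AutomorphicRepData (AutomorphyDatum.gl n K hcpt))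
    (ι : PadicAlgCl ℓ ≃+* ℂ) {m : ℕ} (hm : m ≠ 0) {B : Set ℕ} (hB : B.Finite)
    (E : HeightOneSpectrum (𝓞 K) → Multiset (PadicAlgCl ℓ))
    (hE : ∀ (v : HeightOneSpectrum (𝓞 K)) (α : Multiset ℂ), π.HasSatakeParamAt v α →
      ((E v).map fun a ↦ X - C a).prod = arithFrobPolyOfSatake ι v.residueCard n α)
    (ρ : ∀ i : GoodPrime K m B, FramedGaloisRep (sqrtNegField K i.1) (PadicAlgCl ℓ) n)
    (hss : ∀ i, (ρ i).toGaloisRep.IsSemisimple) (hρ : ∀ i, CompatibleAE E (ρ i))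
    (hT : ∀ q : ℕ, q.Prime → q ≠ ℓ → π.IsUnramifiedAbove q →
      ∀ v : HeightOneSpectrum (𝓞 K), ((q : ℕ) : 𝓞 K) ∈ v.asIdeal →
        ∃ i : GoodPrime K m B, (v.asIdeal.primesOver (𝓞 (sqrtNegField K i.1))).ncard = 2 ∧
          ∀ w : HeightOneSpectrum (𝓞 (sqrtNegField K i.1)), w.asIdeal.under (𝓞 K) = v.asIdeal →
            (ρ i).IsUnramifiedAt w ∧
              (ρ i).HasFrobCharpolyAt w (((E v).map fun a ↦ X - C a).prod)) :
    ∃ r : FramedGaloisRep K (PadicAlgCl ℓ) n, r.toGaloisRep.IsSemisimple ∧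
      IsCompatible π ι r ∧
      ∀ i, Nonempty (ContinuousRep.Equiv
        (r.restrictField (sqrtNegField K i.1)).toGaloisRep (ρ i).toGaloisRep) := by
  set T : Set (HeightOneSpectrum (𝓞 K)) :=
    {v | ∃ q : ℕ, q.Prime ∧ q ≠ ℓ ∧ π.IsUnramifiedAbove q ∧ ((q : ℕ) : 𝓞 K) ∈ v.asIdeal} with hTdef
  obtain ⟨r, hrss, hr, hrT⟩ := GoodPrime.exists_framedGaloisRep_of_compatibleAE hm hB E ρ hss hρ T
    (fun v hv ↦ by
      obtain ⟨q, hq, hqℓ, hπ, hv⟩ := hv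
      exact hT q hq hqℓ hπ v hv)
  refine ⟨r, hrss, fun q hq hqℓ hπ v hv α hα ↦ ?_, hr⟩
  obtain ⟨hunr, hch⟩ := hrT v ⟨q, hq, hqℓ, hπ, hv⟩
  refine ⟨hunr, ?_⟩
  rw [← hE v α hα]
  exact hch

/-- The same with the Frobenius datum chosen internally (`exists_frobDatum`): the hypotheses on
the members are then stated through the Satake polynomials of `π` directly — almost-everywhere
compatibility `CompatibleAE E ρ_D` for *some* datum `E` of `π`, and, over the good rational
primes, compatibility of a split member's `ρ_D` with `arithFrobPolyOfSatake ı q_v n α_v` at the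
places above `v`. [cite: HarrisLanTaylorThorneRMS2016, proof of Cor. 7.14 (p. 232)] -/
theorem exists_isCompatible_of_members' (π : AutomorphicRepData (AutomorphyDatum.gl n K hcpt))
    (ι : PadicAlgCl ℓ ≃+* ℂ) {m : ℕ} (hm : m ≠ 0) {B : Set ℕ} (hB : B.Finite)
    (h : ∀ E : HeightOneSpectrum (𝓞 K) → Multiset (PadicAlgCl ℓ),
      (∀ (v : HeightOneSpectrum (𝓞 K)) (α : Multiset ℂ), π.HasSatakeParamAt v α →
        ((E v).map fun a ↦ X - C a).prod = arithFrobPolyOfSatake ι v.residueCard n α) →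
      ∃ (ρ : ∀ i : GoodPrime K m B, FramedGaloisRep (sqrtNegField K i.1) (PadicAlgCl ℓ) n),
        (∀ i, (ρ i).toGaloisRep.IsSemisimple) ∧ (∀ i, CompatibleAE E (ρ i)) ∧
        ∀ q : ℕ, q.Prime → q ≠ ℓ → π.IsUnramifiedAbove q →
          ∀ v : HeightOneSpectrum (𝓞 K), ((q : ℕ) : 𝓞 K) ∈ v.asIdeal →
            ∃ i : GoodPrime K m B, (v.asIdeal.primesOver (𝓞 (sqrtNegField K i.1))).ncard = 2 ∧
              ∀ w : HeightOneSpectrum (𝓞 (sqrtNegField K i.1)),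
                w.asIdeal.under (𝓞 K) = v.asIdeal → ∀ α : Multiset ℂ, π.HasSatakeParamAt v α →
                  (ρ i).IsUnramifiedAt w ∧
                    (ρ i).HasFrobCharpolyAt w (arithFrobPolyOfSatake ι v.residueCard n α)) :
    ∃ r : FramedGaloisRep K (PadicAlgCl ℓ) n, r.toGaloisRep.IsSemisimple ∧ IsCompatible π ι r := by
  obtain ⟨E, hE⟩ := exists_frobDatum π ι
  obtain ⟨ρ, hss, hρ, hT⟩ := h E hE
  -- at a place over a good `q`, `π` is unramified: pick its Satake parameter
  have hT' : ∀ q : ℕ, q.Prime → q ≠ ℓ → π.IsUnramifiedAbove q →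
      ∀ v : HeightOneSpectrum (𝓞 K), ((q : ℕ) : 𝓞 K) ∈ v.asIdeal →
        ∃ i : GoodPrime K m B, (v.asIdeal.primesOver (𝓞 (sqrtNegField K i.1))).ncard = 2 ∧
          ∀ w : HeightOneSpectrum (𝓞 (sqrtNegField K i.1)), w.asIdeal.under (𝓞 K) = v.asIdeal →
            (ρ i).IsUnramifiedAt w ∧
              (ρ i).HasFrobCharpolyAt w (((E v).map fun a ↦ X - C a).prod) := by
    intro q hq hqℓ hπ v hv
    obtain ⟨α, hα⟩ := (π.isUnramifiedAbove_iff q).mp hπ v hv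
    obtain ⟨i, hsplit, hw⟩ := hT q hq hqℓ hπ v hv
    refine ⟨i, hsplit, fun w hwv ↦ ?_⟩
    rw [hE v α hα]
    exact hw w hwv α hα
  obtain ⟨r, hrss, hc, -⟩ := exists_isCompatible_of_members π ι hm hB E hE ρ hss hρ hT'
  exact ⟨r, hrss, hc⟩

end Literature.NumberTheory.Automorphic.HarrisLanTaylorThorne2016
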